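import Summits.CriticalPhenomena.CardyFormulaZ2.Theorems.HalfPlaneMarkDensityLaw.Negative.MarkEvents
import Literature.Probability.Percolation.Crossings

/-!
# `HalfPlaneMarkDensityLaw` (crux stmt-CriticalPhenomena-5661), line `Sketch`:
# stub `stub_dualEdge_shares` — the dual edge of a pair shares a site with it

Planar duality on `ℤ² = Site 2` indexes the dual vertex `x + (½, ½)` by the lower-left corner `x`
of its face, and `dualEdge {x, y}` of a lattice edge `{x, y}` is a pair containing the lower-left
endpoint `x ⊓ y` of the edge; on pairs that are not lattice edges `dualEdge` is the identity.
In either case `dualEdge e` and `e` have a site in common (wave 2 locality helper: a dual event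
read inside a face region and a primal event read inside a vertex region with disjoint site sets
are determined by disjoint edge sets).

* `inf_mem_mk_of_sup_eq_inf_add_single`: if the join of two sites exceeds their meet by a unit
  coordinate vector, the two sites are comparable, so their meet is one of them.
* `stub_dualEdge_shares`: case analysis on the three branches of `dualEdge`.
-/

noncomputable section

namespace Summit.CriticalPhenomena.CardyFormulaZ2.Cruxes.HalfPlaneMarkDensityLaw.SketchLine

open Literature.Probability.Percolation Literature.Probability.LatticeModels
open MeasureTheory Filter Set SimpleGraph
open scoped Topology
open Summit.CriticalPhenomena.CardyFormulaZ2.Theorems.HalfPlaneMarkDensityLaw.Negative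

namespace Window

/-- Two sites of `ℤ²` whose join exceeds their meet by a unit coordinate vector are comparable,
so their meet is one of the two sites. [folklore] -/
lemma inf_mem_mk_of_sup_eq_inf_add_single (x y : Site 2) (i : Fin 2)
    (h : x ⊔ y = x ⊓ y + Pi.single i 1) : x ⊓ y ∈ s(x, y) := by
  have h0 := congr_fun h 0
  have h1 := congr_fun h 1
  simp only [Pi.sup_apply, Pi.inf_apply, Pi.add_apply] at h0 h1
  have hc : x ≤ y ∨ y ≤ x := by
    simp only [Pi.le_def, Fin.forall_fin_two]
    fin_cases i
    · simp only [Fin.zero_eta, Fin.isValue, Pi.single_eq_same, ne_eq, one_ne_zero,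
        not_false_eq_true, Pi.single_eq_of_ne, add_zero] at h0 h1
      omega
    · simp only [Fin.mk_one, Fin.isValue, ne_eq, zero_ne_one, not_false_eq_true,
        Pi.single_eq_of_ne, add_zero, Pi.single_eq_same] at h0 h1
      omega
  rcases hc with hc | hc
  · exact Sym2.mem_iff.2 (Or.inl (inf_eq_left.2 hc))
  · exact Sym2.mem_iff.2 (Or.inr (inf_eq_right.2 hc))

/-- **Locality helper**: the dual edge of any pair shares a site with it — the lower-left endpoint
of a lattice edge, or the pair itself on non-edges. [folklore] -/
theorem stub_dualEdge_shares :
    ∀ e : Sym2 (Site 2), ∃ w ∈ dualEdge e, w ∈ e := by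
  intro e
  induction e using Sym2.ind with
  | h x y =>
    simp only [dualEdge, Sym2.lift_mk]
    split_ifs with h₀ h₁
    · exact ⟨x ⊓ y, Sym2.mem_mk_right _ _, inf_mem_mk_of_sup_eq_inf_add_single x y 0 h₀⟩
    · exact ⟨x ⊓ y, Sym2.mem_mk_right _ _, inf_mem_mk_of_sup_eq_inf_add_single x y 1 h₁⟩
    · exact ⟨x, Sym2.mem_mk_left _ _, Sym2.mem_mk_left _ _⟩

end Window

end Summit.CriticalPhenomena.CardyFormulaZ2.Cruxes.HalfPlaneMarkDensityLaw.SketchLine
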